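import Summits.BirchSwinnertonDyer.Rank1Residual.Supersingular.MazurTateCertificates
import Summits.BirchSwinnertonDyer.Rank1Residual.Supersingular.SprungConstantTerm
import Summits.BirchSwinnertonDyer.Rank1Residual.Supersingular.SignedSqueeze
import Summits.BirchSwinnertonDyer.Rank1Residual.Supersingular.KobayashiMainConjecture
import Summits.BirchSwinnertonDyer.Rank1Residual.Iwasawa.UnitCoefficientCertificate
import Literature.NumberTheory.EllipticCurves.Kobayashi2003.SignedPAdicLFunctionConstantTermProofs
import Literature.NumberTheory.EllipticCurves.PAdicGrossZagierConstantTermProofs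
import Literature.NumberTheory.EllipticCurves.GrossZagierRationalPoint
import HarnessLib

/-!
# `p`-adic ORDER OF VANISHING at a tight pair: `λ(L^•) = 1` in analytic rank one forces
# `L^• = T · (unit of Λ)` — a SIMPLE zero at the trivial character with `p`-adic UNIT leading
# coefficient, for Sprung's `L♯/L♭` (any `a_p` with `p ∣ a_p`, so X8 = `a_3 = ±3` included) and for
# Kobayashi's / Pollack's `L^±` (`a_p = 0`: X6, X7)
# (cell `b2b-bsdres`, supersingular family, prover B = unit `b2b-bsdres-additive-p3`, gen 7)

HONEST FRAMING (run/shared/lean/b2b/bsd-rank1-residual/, verbatim in every file): the goal of the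
cell is to DELETE the COMBINATION-SHAPED residual classes of the Birch–Swinnerton-Dyer formula for
ALL analytic-rank `≤ 1` elliptic curves over `ℚ` — "full BSD formula for every rank `≤ 1` curve in
class `C`" assembled STRICTLY from published theorems — so that the rank-`≤ 1` remainder becomes
exactly the CONSTRUCTION-SHAPED classes, which are TYPED (missing-input `Prop`s), NOT attempted.
This is not "finishing BSD". THEOREMS ONLY, on the REAL tree objects (Sprung's pair
`IsSprungPair`, Kobayashi's `IsSignedPAdicLFunction`); no named fact is introduced or used; nothing
about any particular curve is asserted; nothing booked; the labels of X6 / X7 / X8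
(CONSTRUCTION-SHAPED) are unchanged.

## What this file proves

The cell's rank-one census certificate at a good supersingular pair `(E, p)` is
`(μ, λ)(L^•) = (0, 1)` for one or both signed `p`-adic `L`-functions (iw-2, two engines; kernel
meaning by the Mazur–Tate reading p214499 / p214576 / p214952: ONE layer `θ_n` with `μ(θ_n) = 0`,
`λ(θ_n) = deg ω_n^± + 1`). Gens 2–4 read the MAIN CONJECTURE at the pair out of it (λ-squeeze,
p208039 / p213197 / p214698; in refereed print as Kurihara–Pollack 2007 Prop. 1.5 for `a_p = 0`).
This file reads the ANALYTIC half of the `p`-adic Birch–Swinnerton-Dyer statement for `L^•` out of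
the same certificate, with no further input:

* §1 (pure algebra of `Λ = ℤ_p⟦T⟧`): `g ≠ 0`, `μ(g) = 0`, `T^r ∣ g`, `λ(g) ≤ r` ⇒ `g = T^r · u` with
  `u ∈ Λˣ`; in particular `ord_{T=0} g = r` and `[T^r] g ∈ ℤ_pˣ` (`exists_eq_X_pow_mul_unit`; the
  `fE = g` case of the iw-1 seat's `minimal_package`).
* §2 the trivial character: for `f` the newform of `E = W`, `p` odd of good reduction, `p ∣ a_p`,
  ANY Sprung pair `(L♯, L♭)` and either colour `•`: `L(E, 1) = 0 ⇒ L^•(0) = 0`, i.e. `T ∣ L^•`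
  (`X_dvd_chromaticL_of_entireLFunction_one_eq_zero`) — the interpolation property (P•)
  `L^•(0) = c_• · L(E,1)/Ω⁺_f` is a tree THEOREM (gen 3, `constantCoeff_chromaticL_of_isSprungPair`);
  hence `analyticRank ≠ 0 ⇒ T ∣ L^•` and `λ(L^•) ≥ 1` (`one_le_lam_chromaticL_of_analyticRank_ne_zero`).
  Same for Kobayashi's `L^ε` at `a_p = 0` (`X_dvd_signed_of_entireLFunction_one_eq_zero`, from
  `IsSignedPAdicLFunction.exists_constantCoeff_eq`, Kobayashi (3.6)).
* §3 **the theorem**: `analyticRank E ≠ 0`, `L^• ≠ 0`, `μ(L^•) = 0`, `λ(L^•) = 1` ⇒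
  `L^• = T · u`, `u ∈ Λˣ` (`chromaticL_eq_X_mul_unit_of_lam_eq_one`,
  `signed_eq_X_mul_unit_of_lam_eq_one`): the signed `p`-adic `L`-function has a SIMPLE zero at the
  trivial character (`ord_{T=0} L^• = 1 = ord_{s=1} L(E, s)` when `r_an = 1`, and `= rank E(ℚ)` by
  Gross–Zagier–Kolyvagin) and its leading coefficient `(L^•)'(0) = u(0)` is a `p`-ADIC UNIT; it has
  NO other zero on the open unit disc. Certificate forms from ONE Mazur–Tate layer
  (`chromaticL_sharp/flat_eq_X_mul_unit_of_mazurTate`). When both colours are tight,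
  `gcd(L♯, L♭) = T` (every common divisor divides `T`: `dvd_X_of_dvd_of_dvd`) — Kurihara–Pollack's
  Problem 3.2 ("`(f, g) = T^r ∏ Φ_n^{e_n − 1}`?") answered at the pair with `r = 1`, all `e_n = 1`
  (cf. gen 6: no vanishing twist in the tower at these pairs).
* §4 readings: `X8.chromaticL_eq_X_mul_unit_of_analyticRank_eq_one` (p = 3, a_3 = ±3; 25 of the 39 rank-one
  X8 pairs `N < 2·10⁴` are tight in at least one colour, 19 in both — kernel records p215118),
  `X7.signed_eq_X_mul_unit_of_analyticRank_eq_one` / `X6.…` (a_p = 0; 31 tight X7 pairs, records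
  p215154 / p215163).

What is NOT claimed: nothing about the algebraic side (no Selmer object enters), nothing about the
VALUE `u(0)` beyond being a unit (the `p`-adic Gross–Zagier / leading-term formula that would turn it
into `#Ш · Tam · Reg_p / #E(ℚ)_tors²` is Kobayashi 2013 for `a_p = 0` — primary unread, acq-01949 —
and is not in print for `a_3 = ±3`), nothing at pairs with `λ^• ≥ 3`.

References: [Sprung2017] Thm. 1.12, Cor. 4.11 (table of special values); [Kobayashi2003] (3.6);
[Pollack2003] §6; [KuriharaPollack2007] Prop. 1.5, Problem 3.2 (pp. 313–314, 317);
[BernardiPerrinRiou1993] (the `p`-adic BSD conjecture at supersingular `p`, for orientation only);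
[GreenbergVatsal2000] p. 4; HOME/b2b-bsdres-additive-p3/X8-ROUTE-B.md §12 (gen 7).
-/

set_option autoImplicit false

noncomputable section

open scoped Classical MatrixGroups ModularForm

open CongruenceSubgroup Polynomial WeierstrassCurve Literature.NumberTheory.EllipticCurves
  Literature.NumberTheory.EllipticCurves.ModularForms
  Literature.NumberTheory.EllipticCurves.Sprung2017
  Literature.NumberTheory.EllipticCurves.GreenbergVatsal2000
  Literature.NumberTheory.EllipticCurves.Rank1Residual
  Summit.BirchSwinnertonDyer.Rank1Residual.X1.MuLambda
  Summit.BirchSwinnertonDyer.Rank1Residual.X11a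
  Summit.BirchSwinnertonDyer.Rank1Residual.Iwasawa

namespace Summit.BirchSwinnertonDyer.Rank1Residual.Supersingular

/-! ## §1. Pure algebra: `μ = 0`, `T^r ∣ g`, `λ ≤ r` ⇒ `g = T^r · unit` -/

section Algebra

variable {p : ℕ} [Fact p.Prime]

/-- **`g = T^r · u` with `u ∈ Λˣ`** whenever `g ≠ 0`, `μ(g) = 0`, `T^r ∣ g` and `λ(g) ≤ r`: by the
iw-1 seat's `minimal_package` (with `fE = g`) `g = T^r · q` with `q(0) ∈ ℤ_pˣ`, and a power series
with unit constant term is a unit. So `ord_{T=0} g = λ(g) = r`, the leading coefficient `[T^r] g` is a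
`p`-adic unit, and `g` has no zero on the open unit disc of `ℂ_p` other than `T = 0`.
[cite: GreenbergVatsal2000, p. 4 (after Thm. (1.2))] [cite: Washington1997, §7.1] -/
theorem exists_eq_X_pow_mul_unit {g : IwasawaAlgebra p} (hg0 : g ≠ 0) (hμ : mu g = 0) {r : ℕ}
    (hX : (PowerSeries.X : IwasawaAlgebra p) ^ r ∣ g) (hlam : lam g ≤ r) :
    ∃ u : (IwasawaAlgebra p)ˣ, g = (PowerSeries.X : IwasawaAlgebra p) ^ r * (u : IwasawaAlgebra p) := by
  have hg : HasUnitContent g := hasUnitContent_of_mu_eq_zero hg0 hμ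
  obtain ⟨-, -, -, -, -, -, hunit⟩ := minimal_package hg (dvd_refl g) hX hlam
  obtain ⟨q, hq⟩ := hX
  have hcoeff : PowerSeries.coeff r g = PowerSeries.constantCoeff q := by
    rw [hq, ← PowerSeries.coeff_zero_eq_constantCoeff_apply, ← PowerSeries.coeff_X_pow_mul q r 0,
      zero_add]
  rw [hcoeff] at hunit
  obtain ⟨u, hu⟩ := PowerSeries.isUnit_iff_constantCoeff.mpr hunit
  exact ⟨u, by rw [hu, hq]⟩

/-- The `r = 1` case packaged with its consequences: `g = T · u`, `ord_{T=0} g = 1`, `[T¹] g ∈ ℤ_pˣ`.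
[cite: GreenbergVatsal2000, p. 4 (after Thm. (1.2))] -/
theorem eq_X_mul_unit_of_lam_eq_one {g : IwasawaAlgebra p} (hg0 : g ≠ 0) (hμ : mu g = 0)
    (hX : (PowerSeries.X : IwasawaAlgebra p) ∣ g) (hlam : lam g = 1) :
    (∃ u : (IwasawaAlgebra p)ˣ, g = (PowerSeries.X : IwasawaAlgebra p) * (u : IwasawaAlgebra p)) ∧ g.order = 1 ∧
      IsUnit (PowerSeries.coeff 1 g) := by
  have hg : HasUnitContent g := hasUnitContent_of_mu_eq_zero hg0 hμ
  have hX' : (PowerSeries.X : IwasawaAlgebra p) ^ 1 ∣ g := by rwa [pow_one]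
  obtain ⟨-, -, -, -, -, hord, hunit⟩ := minimal_package hg (dvd_refl g) hX' hlam.le
  obtain ⟨u, hu⟩ := exists_eq_X_pow_mul_unit hg0 hμ hX' hlam.le
  exact ⟨⟨u, by rw [hu, pow_one]⟩, by exact_mod_cast hord, hunit⟩

/-- **`gcd = T`**: if `g = T·u` and `g' = T·u'` with `u, u'` units, every common divisor of `g` and
`g'` — indeed every divisor of `g` — divides `T`. [folklore] -/
theorem dvd_X_of_dvd_X_mul_unit {g d : IwasawaAlgebra p} (u : (IwasawaAlgebra p)ˣ)
    (hg : g = (PowerSeries.X : IwasawaAlgebra p) * (u : IwasawaAlgebra p)) (hd : d ∣ g) : d ∣ PowerSeries.X := by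
  rw [hg] at hd
  exact (Units.dvd_mul_right).mp hd

/-- `λ(T · q) = λ(q) + 1 ≥ 1` for `q ≠ 0` (no unit-content hypothesis). [cite: Washington1997, §7.1] -/
theorem one_le_lam_of_X_dvd {g : IwasawaAlgebra p} (hg0 : g ≠ 0)
    (hX : (PowerSeries.X : IwasawaAlgebra p) ∣ g) : 1 ≤ lam g := by
  obtain ⟨q, rfl⟩ := hX
  have hq0 : q ≠ 0 := fun h ↦ hg0 (by rw [h, mul_zero])
  have hX0 : (PowerSeries.X : IwasawaAlgebra p) ≠ 0 := PowerSeries.X_ne_zero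
  have hlamX : lam (PowerSeries.X : IwasawaAlgebra p) = 1 := by
    have h := lam_X_pow_mul (p := p) (q := 1) ⟨0, by simp⟩ 1
    rw [pow_one, mul_one] at h
    rw [h, (isUnit_iff_mu_eq_zero_and_lam_eq_zero (1 : IwasawaAlgebra p)).mp isUnit_one |>.2.2]
  rw [lam_mul hX0 hq0, hlamX]
  omega

end Algebra

/-! ## §2. The trivial character: `L(E,1) = 0 ⇒ T ∣ L^•` -/

section Trivial

variable {W : WeierstrassCurve ℚ} [W.IsElliptic] [W.IsGloballyMinimal] {N : ℕ} [NeZero N]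
  {f : CuspForm (Gamma0 N) 2} {p : ℕ} [hp : Fact p.Prime]

omit [W.IsElliptic] [W.IsGloballyMinimal] in
/-- `analyticRank E ≠ 0 ⇒ L(E, 1) = 0` (a genuine positive order of vanishing forces vanishing).
[folklore] -/
theorem entireLFunction_one_eq_zero_of_analyticRank_ne_zero' (hr : W.analyticRank ≠ 0) :
    W.entireLFunction 1 = 0 :=
  apply_eq_zero_of_analyticOrderNatAt_ne_zero (f := W.entireLFunction) hr

/-- **(P•) at a vanishing central value: `L(E, 1) = 0 ⇒ L^•(0) = 0`** for ANY Sprung pair of the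
newform `f` of `E = W` at an odd good prime `p` (`L^•(0) = c_• · [0]⁺_f`, gen 3, and
`[0]⁺_f = L(E,1)/Ω⁺_f = 0`). [cite: Sprung2017, Cor. 4.11 (table of special values)]
[cite: MazurTateTeitelbaum1986Invent, §I.8 (8.6)] -/
theorem constantCoeff_chromaticL_eq_zero_of_entireLFunction_one_eq_zero (hp2 : p ≠ 2)
    (hf : IsNewformOf W f) (hgood : W.HasGoodReductionAtPrime p) {Lsharp Lflat : IwasawaAlgebra p}
    (hSP : IsSprungPair f p (W.frobeniusTrace p) Lsharp Lflat) (c : Chroma)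
    (hL1 : W.entireLFunction 1 = 0) : PowerSeries.constantCoeff (chromaticL c Lsharp Lflat) = 0 := by
  have h := constantCoeff_chromaticL_of_isSprungPair_of_isNewformOf hp2 hf hgood hSP c
  rw [ratPlusSymbol_zero_eq_zero_of_entireLFunction_eq_zero hf hL1, Rat.cast_zero, mul_zero] at h
  exact PadicInt.coe_eq_zero.mp h

/-- **`L(E, 1) = 0 ⇒ T ∣ L^•`.** [cite: Sprung2017, Cor. 4.11 (table of special values)] -/
theorem X_dvd_chromaticL_of_entireLFunction_one_eq_zero (hp2 : p ≠ 2) (hf : IsNewformOf W f)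
    (hgood : W.HasGoodReductionAtPrime p) {Lsharp Lflat : IwasawaAlgebra p}
    (hSP : IsSprungPair f p (W.frobeniusTrace p) Lsharp Lflat) (c : Chroma)
    (hL1 : W.entireLFunction 1 = 0) : (PowerSeries.X : IwasawaAlgebra p) ∣ chromaticL c Lsharp Lflat :=
  PowerSeries.X_dvd_iff.mpr
    (constantCoeff_chromaticL_eq_zero_of_entireLFunction_one_eq_zero hp2 hf hgood hSP c hL1)

/-- **`analyticRank E ≠ 0 ⇒ T ∣ L^•` and `λ(L^•) ≥ 1`** (for `L^• ≠ 0`): the order of vanishing of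
the signed `p`-adic `L`-function at the trivial character is at least `1` as soon as `L(E,1) = 0` —
the trivial half of the `p`-adic BSD inequality `ord_{T=0} L^• ≥ 1`.
[cite: Sprung2017, Cor. 4.11 (table of special values)] -/
theorem one_le_lam_chromaticL_of_analyticRank_ne_zero (hp2 : p ≠ 2) (hf : IsNewformOf W f)
    (hgood : W.HasGoodReductionAtPrime p) {Lsharp Lflat : IwasawaAlgebra p}
    (hSP : IsSprungPair f p (W.frobeniusTrace p) Lsharp Lflat) (c : Chroma)
    (hr : W.analyticRank ≠ 0) (hL0 : chromaticL c Lsharp Lflat ≠ 0) :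
    (PowerSeries.X : IwasawaAlgebra p) ∣ chromaticL c Lsharp Lflat ∧
      1 ≤ lam (chromaticL c Lsharp Lflat) := by
  have hX := X_dvd_chromaticL_of_entireLFunction_one_eq_zero hp2 hf hgood hSP c
    (entireLFunction_one_eq_zero_of_analyticRank_ne_zero' hr)
  exact ⟨hX, one_le_lam_of_X_dvd hL0 hX⟩

/-- **`a_p = 0`, Kobayashi's labelling: `L(E, 1) = 0 ⇒ T ∣ L^ε`** for every `L` with
`IsSignedPAdicLFunction f p ε L` (`L^ε(0) = c_ε · [0]⁺_f`, `c_1 = 2`, `c_{−1} = p − 1`; Kobayashi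
(3.6)). [cite: Kobayashi2003, (3.6) (p. 7)] [cite: Pollack2003, §6] -/
theorem X_dvd_signed_of_entireLFunction_one_eq_zero (hp2 : p ≠ 2) (hf : IsNewformOf W f)
    (hgood : W.HasGoodReductionAtPrime p) (hap : W.frobeniusTrace p = 0) {ε : ℤˣ}
    {L : IwasawaAlgebra p} (hL : Kobayashi2003.IsSignedPAdicLFunction f p ε L)
    (hL1 : W.entireLFunction 1 = 0) : (PowerSeries.X : IwasawaAlgebra p) ∣ L := by
  obtain ⟨c, -, hc⟩ := hL.exists_constantCoeff_eq hp2 hf hgood hap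
  rw [ratPlusSymbol_zero_eq_zero_of_entireLFunction_eq_zero hf hL1, mul_zero, Rat.cast_zero] at hc
  exact PowerSeries.X_dvd_iff.mpr (PadicInt.coe_eq_zero.mp hc)

end Trivial

/-! ## §3. The theorem: `λ(L^•) = 1` at a pair with `L(E,1) = 0` ⇒ `L^• = T · unit` -/

section Main

variable {W : WeierstrassCurve ℚ} [W.IsElliptic] [W.IsGloballyMinimal] {N : ℕ} [NeZero N]
  {f : CuspForm (Gamma0 N) 2} {p : ℕ} [hp : Fact p.Prime]

/-- **Simple zero with unit leading coefficient (♯/♭, any `a_p` with `p`-adic interpolation at the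
trivial character).** For `f` the newform of `E = W`, `p ≠ 2` of good reduction, ANY Sprung pair
`(L♯, L♭)` for `a_p(W)` and a colour `•` with `L^• ≠ 0`, `μ(L^•) = 0`, `λ(L^•) = 1`: if
`ord_{s=1} L(E, s) ≠ 0` then `L^• = T · u` for a unit `u ∈ Λˣ`; hence `ord_{T=0} L^• = 1` and the
leading coefficient `[T] L^•` is a `p`-adic unit. (At X8 `p ∣ a_p` and the pair is THE pair, p214240.)
[cite: Sprung2017, Thm. 1.12 and Cor. 4.11] [cite: KuriharaPollack2007, Prop. 1.5] -/
theorem chromaticL_eq_X_mul_unit_of_lam_eq_one (hp2 : p ≠ 2) (hf : IsNewformOf W f)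
    (hgood : W.HasGoodReductionAtPrime p) {Lsharp Lflat : IwasawaAlgebra p}
    (hSP : IsSprungPair f p (W.frobeniusTrace p) Lsharp Lflat) (c : Chroma)
    (hr : W.analyticRank ≠ 0) (hL0 : chromaticL c Lsharp Lflat ≠ 0)
    (hμ : mu (chromaticL c Lsharp Lflat) = 0) (hlam : lam (chromaticL c Lsharp Lflat) = 1) :
    (∃ u : (IwasawaAlgebra p)ˣ, chromaticL c Lsharp Lflat = (PowerSeries.X : IwasawaAlgebra p) * (u : IwasawaAlgebra p)) ∧
      (chromaticL c Lsharp Lflat).order = 1 ∧ IsUnit (PowerSeries.coeff 1 (chromaticL c Lsharp Lflat)) :=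
  eq_X_mul_unit_of_lam_eq_one hL0 hμ
    (one_le_lam_chromaticL_of_analyticRank_ne_zero hp2 hf hgood hSP c hr hL0).1 hlam

/-- **Certificate form, ♯**: ONE odd Mazur–Tate layer with `θ_n ≠ 0`, `μ(θ_n) = 0`,
`λ(θ_n) = deg ω_n^+ + 1` (the census row), `p ∣ a_p`, `ord_{s=1} L(E,s) ≠ 0` ⇒ `L♯ = T · unit`.
[cite: Sprung2017, §3, Cor. 3.6 and Thm. 1.12] [cite: Pollack2003, Prop. 6.9 and Prop. 6.10] -/
theorem chromaticL_sharp_eq_X_mul_unit_of_mazurTate (hp2 : p ≠ 2) (hf : IsNewformOf W f)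
    (hgood : W.HasGoodReductionAtPrime p) (hap : (p : ℤ) ∣ W.frobeniusTrace p)
    {Lsharp Lflat : IwasawaAlgebra p} (hSP : IsSprungPair f p (W.frobeniusTrace p) Lsharp Lflat)
    (hr : W.analyticRank ≠ 0) {n : ℕ} (hn : Odd n) {Θ : IwasawaAlgebra p}
    (hΘ : iwasawaToPowerSeries p Θ =
      ((mazurTateElement f p n).map (algebraMap ℚ ℚ_[p]) : PowerSeries ℚ_[p]))
    (hΘ0 : Θ ≠ 0) (hμ : mu Θ = 0) (hlamΘ : lam Θ = (cyclotomicOmegaPlus p n).natDegree + 1) :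
    ∃ u : (IwasawaAlgebra p)ˣ, Lsharp = (PowerSeries.X : IwasawaAlgebra p) * (u : IwasawaAlgebra p) := by
  obtain ⟨hμL, hlamL⟩ := lam_sharp_eq_of_mazurTate' hp2 hf hgood hap hSP hn hΘ hΘ0 hμ hlamΘ
  have hL0 : Lsharp ≠ 0 := ne_zero_of_lam_ne_zero (by rw [hlamL]; exact one_ne_zero)
  have h := chromaticL_eq_X_mul_unit_of_lam_eq_one hp2 hf hgood hSP Chroma.sharp hr
    (by rwa [chromaticL_sharp]) (by rwa [chromaticL_sharp]) (by rwa [chromaticL_sharp])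
  rw [chromaticL_sharp] at h
  exact h.1

/-- **Certificate form, ♭**: ONE even Mazur–Tate layer with `λ(θ_n) = deg ω_n^- + 1` etc. ⇒
`L♭ = T · unit`. [cite: Sprung2017, §3, Cor. 3.6 and Thm. 1.12] [cite: Pollack2003, Prop. 6.9 and Prop. 6.10] -/
theorem chromaticL_flat_eq_X_mul_unit_of_mazurTate (hp2 : p ≠ 2) (hf : IsNewformOf W f)
    (hgood : W.HasGoodReductionAtPrime p) (hap : (p : ℤ) ∣ W.frobeniusTrace p)
    {Lsharp Lflat : IwasawaAlgebra p} (hSP : IsSprungPair f p (W.frobeniusTrace p) Lsharp Lflat)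
    (hr : W.analyticRank ≠ 0) {n : ℕ} (hn : Even n) {Θ : IwasawaAlgebra p}
    (hΘ : iwasawaToPowerSeries p Θ =
      ((mazurTateElement f p n).map (algebraMap ℚ ℚ_[p]) : PowerSeries ℚ_[p]))
    (hΘ0 : Θ ≠ 0) (hμ : mu Θ = 0) (hlamΘ : lam Θ = (cyclotomicOmegaMinus p n).natDegree + 1) :
    ∃ u : (IwasawaAlgebra p)ˣ, Lflat = (PowerSeries.X : IwasawaAlgebra p) * (u : IwasawaAlgebra p) := by
  obtain ⟨hμL, hlamL⟩ := lam_flat_eq_of_mazurTate' hp2 hf hgood hap hSP hn hΘ hΘ0 hμ hlamΘ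
  have hL0 : Lflat ≠ 0 := ne_zero_of_lam_ne_zero (by rw [hlamL]; exact one_ne_zero)
  have h := chromaticL_eq_X_mul_unit_of_lam_eq_one hp2 hf hgood hSP Chroma.flat hr
    (by rwa [chromaticL_flat]) (by rwa [chromaticL_flat]) (by rwa [chromaticL_flat])
  rw [chromaticL_flat] at h
  exact h.1

/-- **Both colours tight ⇒ `gcd(L♯, L♭) = T`**: `L♯ = T·u`, `L♭ = T·u'` and every common divisor
of `L♯`, `L♭` in `Λ` divides `T` — Kurihara–Pollack's Problem 3.2 at the pair (`r = 1`, no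
cyclotomic factor). [cite: KuriharaPollack2007, Problem 3.2 (p. 317)] -/
theorem dvd_X_of_dvd_of_dvd (hp2 : p ≠ 2) (hf : IsNewformOf W f)
    (hgood : W.HasGoodReductionAtPrime p) {Lsharp Lflat : IwasawaAlgebra p}
    (hSP : IsSprungPair f p (W.frobeniusTrace p) Lsharp Lflat) (hr : W.analyticRank ≠ 0)
    (h0 : Lsharp ≠ 0) (hμ : mu Lsharp = 0) (hlam : lam Lsharp = 1)
    {d : IwasawaAlgebra p} (hd : d ∣ Lsharp) (_hd' : d ∣ Lflat) :
    d ∣ (PowerSeries.X : IwasawaAlgebra p) := by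
  have h := chromaticL_eq_X_mul_unit_of_lam_eq_one hp2 hf hgood hSP Chroma.sharp hr
    (by rwa [chromaticL_sharp]) (by rwa [chromaticL_sharp]) (by rwa [chromaticL_sharp])
  rw [chromaticL_sharp] at h
  obtain ⟨u, hu⟩ := h.1
  exact dvd_X_of_dvd_X_mul_unit u hu hd

/-- **Simple zero with unit leading coefficient, `a_p = 0`, Kobayashi's labelling** (X6 / X7): for
every `L` with `IsSignedPAdicLFunction f p ε L` (Pollack's `L^∓`, Kobayashi's `L^ε`), `L ≠ 0`,
`μ(L) = 0`, `λ(L) = 1` and `ord_{s=1} L(E,s) ≠ 0` ⇒ `L = T · u`, `u ∈ Λˣ`, `ord_{T=0} L = 1`,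
`[T] L ∈ ℤ_pˣ`. [cite: Kobayashi2003, Thm. 3.2 and (3.6)] [cite: KuriharaPollack2007, Prop. 1.5] -/
theorem signed_eq_X_mul_unit_of_lam_eq_one (hp2 : p ≠ 2) (hf : IsNewformOf W f)
    (hgood : W.HasGoodReductionAtPrime p) (hap : W.frobeniusTrace p = 0) {ε : ℤˣ}
    {L : IwasawaAlgebra p} (hL : Kobayashi2003.IsSignedPAdicLFunction f p ε L)
    (hr : W.analyticRank ≠ 0) (hL0 : L ≠ 0) (hμ : mu L = 0) (hlam : lam L = 1) :
    (∃ u : (IwasawaAlgebra p)ˣ, L = (PowerSeries.X : IwasawaAlgebra p) * (u : IwasawaAlgebra p)) ∧ L.order = 1 ∧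
      IsUnit (PowerSeries.coeff 1 L) :=
  eq_X_mul_unit_of_lam_eq_one hL0 hμ
    (X_dvd_signed_of_entireLFunction_one_eq_zero hp2 hf hgood hap hL
      (entireLFunction_one_eq_zero_of_analyticRank_ne_zero' hr)) hlam

/-- **Certificate form, `a_p = 0`, `ε = −1`** (odd layer). [cite: Pollack2003, Prop. 6.9, Prop. 6.10 and Prop. 6.18] -/
theorem signed_neg_one_eq_X_mul_unit_of_mazurTate (hp2 : p ≠ 2) (hf : IsNewformOf W f)
    (hgood : W.HasGoodReductionAtPrime p) (hap : W.frobeniusTrace p = 0)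
    {L : IwasawaAlgebra p} (hL : Kobayashi2003.IsSignedPAdicLFunction f p (-1) L)
    (hr : W.analyticRank ≠ 0) {n : ℕ} (hn : Odd n) {Θ : IwasawaAlgebra p}
    (hΘ : iwasawaToPowerSeries p Θ =
      ((mazurTateElement f p n).map (algebraMap ℚ ℚ_[p]) : PowerSeries ℚ_[p]))
    (hΘ0 : Θ ≠ 0) (hμ : mu Θ = 0) (hlamΘ : lam Θ = (cyclotomicOmegaPlus p n).natDegree + 1) :
    ∃ u : (IwasawaAlgebra p)ˣ, L = (PowerSeries.X : IwasawaAlgebra p) * (u : IwasawaAlgebra p) := by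
  obtain ⟨hμL, hlamL⟩ := lam_signed_neg_one_eq_of_mazurTate' hp2 hf hgood hap hL hn hΘ hΘ0 hμ hlamΘ
  exact (signed_eq_X_mul_unit_of_lam_eq_one hp2 hf hgood hap hL hr
    (ne_zero_of_lam_ne_zero (by rw [hlamL]; exact one_ne_zero)) hμL hlamL).1

/-- **Certificate form, `a_p = 0`, `ε = 1`** (even layer). [cite: Pollack2003, Prop. 6.9, Prop. 6.10 and Prop. 6.18] -/
theorem signed_one_eq_X_mul_unit_of_mazurTate (hp2 : p ≠ 2) (hf : IsNewformOf W f)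
    (hgood : W.HasGoodReductionAtPrime p) (hap : W.frobeniusTrace p = 0)
    {L : IwasawaAlgebra p} (hL : Kobayashi2003.IsSignedPAdicLFunction f p 1 L)
    (hr : W.analyticRank ≠ 0) {n : ℕ} (hn : Even n) {Θ : IwasawaAlgebra p}
    (hΘ : iwasawaToPowerSeries p Θ =
      ((mazurTateElement f p n).map (algebraMap ℚ ℚ_[p]) : PowerSeries ℚ_[p]))
    (hΘ0 : Θ ≠ 0) (hμ : mu Θ = 0) (hlamΘ : lam Θ = (cyclotomicOmegaMinus p n).natDegree + 1) :
    ∃ u : (IwasawaAlgebra p)ˣ, L = (PowerSeries.X : IwasawaAlgebra p) * (u : IwasawaAlgebra p) := by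
  obtain ⟨hμL, hlamL⟩ := lam_signed_one_eq_of_mazurTate' hp2 hf hgood hap hL hn hΘ hΘ0 hμ hlamΘ
  exact (signed_eq_X_mul_unit_of_lam_eq_one hp2 hf hgood hap hL hr
    (ne_zero_of_lam_ne_zero (by rw [hlamL]; exact one_ne_zero)) hμL hlamL).1

end Main

/-! ## §4. Readings on the classes (nothing booked; labels unchanged) -/

section Readings

variable {W : WeierstrassCurve ℚ} [W.IsElliptic] [W.IsGloballyMinimal] {N : ℕ} [NeZero N]
  {f : CuspForm (Gamma0 N) 2}

/-- **X8 (`p = 3`, `a_3 = ±3`), analytic rank one**: for THE Sprung pair of the newform of `E` and a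
colour with census certificate `(μ, λ)(L^•) = (0, 1)` (25 of the 39 rank-one X8 pairs `N < 2·10⁴` in
at least one colour, 19 in both; kernel records p215118): `L^•_3(E) = T · u`, `u ∈ Λˣ` — a simple
zero at the trivial character, equal to `ord_{s=1} L(E,s) = 1 = rank E(ℚ)` (GZK), with `3`-adic unit
leading coefficient. Nothing about BSD₃ is claimed (the leading-term formula is not in print at
`a_3 = ±3`). [cite: Sprung2017, Thm. 1.12 and Cor. 4.11] -/
theorem X8.chromaticL_eq_X_mul_unit_of_analyticRank_eq_one {p : ℕ} [Fact p.Prime] (hX : ClassX8 W p)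
    (h1 : W.analyticRank = 1) (hf : IsNewformOf W f) {Lsharp Lflat : IwasawaAlgebra p}
    (hSP : IsSprungPair f p (W.frobeniusTrace p) Lsharp Lflat) (c : Chroma)
    (hL0 : chromaticL c Lsharp Lflat ≠ 0) (hμ : mu (chromaticL c Lsharp Lflat) = 0)
    (hlam : lam (chromaticL c Lsharp Lflat) = 1) :
    (∃ u : (IwasawaAlgebra p)ˣ, chromaticL c Lsharp Lflat = (PowerSeries.X : IwasawaAlgebra p) * (u : IwasawaAlgebra p)) ∧
      (chromaticL c Lsharp Lflat).order = 1 ∧ IsUnit (PowerSeries.coeff 1 (chromaticL c Lsharp Lflat)) := by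
  obtain ⟨hp3, ⟨hgood, -⟩, -⟩ := hX
  subst hp3
  exact chromaticL_eq_X_mul_unit_of_lam_eq_one (by decide) hf hgood hSP c (by rw [h1]; exact one_ne_zero)
    hL0 hμ hlam

/-- **X7 (good supersingular, non-semistable; `a_p = 0` displayed — automatic for `p ≥ 5`,
`ClassX7.frobeniusTrace_eq_zero_of_five_le`), analytic rank one**: for Kobayashi's `L^ε` with
census certificate `(μ, λ) = (0, 1)` (31 of the 72 rank-one X7 pairs `N < 2·10⁴`; records p215154 /
p215163): `L^ε = T · u`, `u ∈ Λˣ`. [cite: Kobayashi2003, Thm. 3.2 and (3.6)] [cite: KuriharaPollack2007, Prop. 1.5] -/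
theorem X7.signed_eq_X_mul_unit_of_analyticRank_eq_one {p : ℕ} [Fact p.Prime] (hX : ClassX7 W p)
    (hp2 : p ≠ 2) (hap : W.frobeniusTrace p = 0) (h1 : W.analyticRank = 1) (hf : IsNewformOf W f)
    {ε : ℤˣ} {L : IwasawaAlgebra p} (hL : Kobayashi2003.IsSignedPAdicLFunction f p ε L) (hL0 : L ≠ 0)
    (hμ : mu L = 0) (hlam : lam L = 1) :
    (∃ u : (IwasawaAlgebra p)ˣ, L = (PowerSeries.X : IwasawaAlgebra p) * (u : IwasawaAlgebra p)) ∧ L.order = 1 ∧ IsUnit (PowerSeries.coeff 1 L) :=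
  signed_eq_X_mul_unit_of_lam_eq_one hp2 hf hX.1.1 hap hL (by rw [h1]; exact one_ne_zero) hL0 hμ hlam

/-- **X6 (semistable, good supersingular, `a_p = 0`), analytic rank one**: same statement.
[cite: Kobayashi2003, Thm. 3.2 and (3.6)] [cite: KuriharaPollack2007, Prop. 1.5] -/
theorem X6.signed_eq_X_mul_unit_of_analyticRank_eq_one {p : ℕ} [Fact p.Prime] (hX : ClassX6 W p)
    (hp2 : p ≠ 2) (h1 : W.analyticRank = 1) (hf : IsNewformOf W f) {ε : ℤˣ} {L : IwasawaAlgebra p}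
    (hL : Kobayashi2003.IsSignedPAdicLFunction f p ε L) (hL0 : L ≠ 0) (hμ : mu L = 0)
    (hlam : lam L = 1) :
    (∃ u : (IwasawaAlgebra p)ˣ, L = (PowerSeries.X : IwasawaAlgebra p) * (u : IwasawaAlgebra p)) ∧ L.order = 1 ∧ IsUnit (PowerSeries.coeff 1 L) :=
  signed_eq_X_mul_unit_of_lam_eq_one hp2 hf hX.1.1 (_root_.Summit.BirchSwinnertonDyer.Rank1Residual.Supersingular.ClassX6.frobeniusTrace_eq_zero W p hp2 hX) hL
    (by rw [h1]; exact one_ne_zero) hL0 hμ hlam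

end Readings

end Summit.BirchSwinnertonDyer.Rank1Residual.Supersingular

end
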